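import Summits.BirchSwinnertonDyer.Rank1Residual.X9.TransportPairsC
import HarnessLib

/-!
# BSD rank-≤1 residual cell, class X9: `BSD(E,5)` by a full `5`-descent for `5S4` pairs, part E — the F1 field: the transport partner `12996j1` and the T-JET literal cell `168948a1` (ONE Zimmert certificate for their shared degree-24 field), class group ZIMMERT-certified

HONEST FRAMING (cell `b2b-bsdres-*`, verbatim): the cell deletes COMBINATION-SHAPED residual classes of
the rank-≤1 BSD formula from PUBLISHED theorems only and TYPES the construction-shaped remainder; this
is not "finishing BSD". Class X9 stays TYPED at class level; everything here is PER PAIR; no lane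
verdict is changed; no named fact; nothing is booked by this unit (the lane books, the referee rules).

Unit `b2b-bsdres-x9`, gen 15. Part E (part D = `8092e1`) of `X9/S4DescentPairsZimmert{A,B,C}.lean` (gen 14; method, engine provenance and
theorem shape identical: x11c gen-13 engine `s4desc` — Schaefer–Stoll `5`-descent over the degree-`24` field `R = ℚ(T′)` of a
`5`-torsion point, image ENFORCED by the subfield lattice of `R`, `K_S(R)` contamination check, local images, `5`-saturation
by quintic characters, Galois action proved by characters; method note `HOME/b2b-bsdres-x11c/gen13/S4DESCENT-METHOD.md` —
BYTE COPIES run by this unit with the engine's independent verifier; PARI's `bnfinit` class group made UNCONDITIONAL by a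
ZIMMERT certificate, Bordellès 2012 Thm. 7.51, x11c gen-13 kit byte copies). The curves here are the rank-ONE PARTNERS of the
Greenberg–Vatsal transport records of `X9/TransportPairs{,B,C}.lean`: a kernel `BSDp` for the partner turns the transport
record's binder `hbsdA` into a theorem (`X9/TransportPairsD.lean` for 8092e1; here, §2, for 12996j1 → 168948a1). What enters the kernel per pair is ONE line
`hSel : #Sel^(5)(E/ℚ) = 5 ^ r_an` of x11c's class-free consumer `X11b.bsdp_of_ainvs_of_card_selmerGroup` (GZK `hGZK`,
`r_an ≤ 1`, `5 ∤ #Ш_an` ⟹ Miller's `BSDp`; `Δ ≠ 0` decided in the kernel). Non-kernel inputs displayed as binders: `hGZK`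
(published), `r_an ≤ 1` and `#Ш_an` (Cremona / the cell's engines), `hSel` (the certificate line, status stated per pair).

References: E. F. Schaefer, M. Stoll, Trans. AMS 356 (2004) §2–3; O. Bordellès, *Arithmetic Tales* (2012) Thm. 7.51
(Zimmert); J. H. Silverman, *AEC* (2009) X.1, X.4 [SilvermanAEC2009]; R. L. Miller, LMS JCM 14 (2011) §1 [Miller2011LMS];
Cremona's tables [Cremona2006].
-/

set_option autoImplicit false

noncomputable section

open scoped Classical MatrixGroups ModularForm

open CongruenceSubgroup WeierstrassCurve Literature.NumberTheory.EllipticCurves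
  Literature.NumberTheory.EllipticCurves.ModularForms Literature.NumberTheory.EllipticCurves.Rank1Residual
  Literature.NumberTheory.EllipticCurves.Rank1Residual.Typed
  Summit.BirchSwinnertonDyer.Rank1Residual.X11b

namespace Summit.BirchSwinnertonDyer.Rank1Residual.X9

/-- **`BSD(E,5)` for `12996j1`** (`N = 12996 = 2²·3²·19²`, good ordinary at `5`, class X9; Cremona model `[0, 0, 0, -20577, -912247]`; `ρ̄_{E,5}` of
EXCEPTIONAL type `5S4`; rank `1`, `#Ш_an = 1`; c₂ = 3 (IV), c₃ = 1 (I0*), c₁₉ = 1 (IV*)). Heegner-index route of record (x9 fold):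
CERT (`D = -71`, `m = 18`, `5 ∤ m`, two engines; unflagged). Rank-ONE transport PARTNER of the N3 cell `168948a1` (`X9/TransportPairsC.lean`): this theorem discharges that record's binder `hbsdA` (composition `bsdp_t168948a1'` below); window class (N < 2·10⁴) carried LITERAL (`JET@p`) in the lane ledger, CERT (D = −71, m = 18, v₅ = 0, two engines) in the x9 fold. Here a SECOND, INDEPENDENT method for the same pair: GZK and the certificate line
`#Sel^(5)(E/ℚ) = 5 ^ r_an` — full `5`-descent over `R = ℚ(E[5]∖0)` (degree `24`; x11c gen-13 engine `s4desc`, byte copies;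
run of record + independent verifier by unit `b2b-bsdres-x9` gen 15, kit j127696; certificate
`HOME/b2b-bsdres-x9/g15/desc5s4/j127696/certs/cert_12996j1.txt.gz`): `S = [2, 3, 5, 19]`, `#gens R(S,5) = 30`, `5`-saturation
`[1, 102, 30]`, `dim K_S(R) = 0`, all local images complete, Galois action proved by characters,
**`dim_𝔽₅ Sel^(5)(E/ℚ) = 1`** with the Kummer image of the generator `[[-67,407]]` its non-zero element (exact 5th root exhibited / in Fake / non-zero); verifier: VERIFIED; the field `R` COINCIDES with the `5`-division-point field of `168948a1` (identical `polredbest` polynomial), ONE Zimmert certificate serving both: the class group of `R` (`bnfinit`: `Cl(R) = [6, [6]]`, `Cl_S(R) = [1, []]`) CERTIFIED UNCONDITIONALLY by a Zimmert certificate (Bordellès Thm. 7.51 bound `Z = 1684755394`; every prime ideal of norm `≤ Z` decomposed on PARI's generators and verified exactly, up to the free action of `Aut(R) ≅ C₄` on degree-1 primes; 83444818 ideals, 0 failures; so `Cl(R)` is a quotient of `[6]` (PARI's cycle structure) — of order prime to `5`, hence `Cl_S(R)[5] = 0` for every `S`, which is all the `5`-descent uses; the certificate's exact `S`-prime verification was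 run for `S = {2,3,5,13,19}` ⊇ this curve's `S`, whose classes generate the computed group; kit j127943, j127944, j127945, j127946, j127947, j127948, j127950, j127951, j127952, j127953, j127954, j127955, 105.3 core-h) — this certificate line is UNCONDITIONAL.
Binders: `hGZK`, `r_an ≤ 1`, `#Ш_an` a `5`-adic unit, `hSel`. Kernel: `Δ ≠ 0`.
[cite: Miller2011LMS, §1 and Def. 1.1] [cite: Cremona2006, Table 1 (Cremona label 12996j1)] -/
theorem bsdp_s12996j1 (hGZK : rank_eq_analyticRank_of_analyticRank_le_one)
    (W : WeierstrassCurve ℚ) (hW : W = ⟨0, 0, 0, -20577, -912247⟩)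
    (hr : W.analyticRank ≤ 1) {q : ℚ} (hq : shaAn W = (q : ℂ)) (hv : padicValRat 5 q = 0)
    (hSel : Nat.card (W.selmerGroup (5 : ℤ)) = 5 ^ W.analyticRank) : BSDp W 5 := by
  subst hW
  haveI : Fact (Nat.Prime 5) := ⟨by norm_num⟩
  exact bsdp_of_ainvs_of_card_selmerGroup hGZK 0 0 0 (-20577) (-912247) (by decide +kernel) 5
    hr hq hv hSel

/-- **`BSD(E,5)` for `168948a1`** (`N = 168948 = 2²·3²·13·19²`, good ordinary at `5`, class X9; Cremona model `[0, 0, 0, -64838127, -448597462250]`; `ρ̄_{E,5}` of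
EXCEPTIONAL type `5S4`; rank `0`, `#Ш_an = 1`; c₂ = 3 (IV*), c₃ = 2 (I10*), c₁₃ = 5 (I5), c₁₉ = 1 (IV*)). Heegner-index route of record (x9 fold):
JETCHEV–CHA (`D = -287`, `m = 120`, `ord₅ m = 1` = `ord₅` of exactly one Tamagawa number; flag `Miller11-Thm54-Cha-case`) — FLAG-FREE here. N3 cell LITERAL T-JET (`JET@nonsurj@5`); also the TARGET of the transport record `bsdp_t168948a1_of_bsdp_s12996j1` (`X9/TransportPairsC.lean`). Here a SECOND, INDEPENDENT method for the same pair: GZK and the certificate line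
`#Sel^(5)(E/ℚ) = 5 ^ r_an` — full `5`-descent over `R = ℚ(E[5]∖0)` (degree `24`; x11c gen-13 engine `s4desc`, byte copies;
run of record + independent verifier by unit `b2b-bsdres-x9` gen 15, kit j129707; certificate
`HOME/b2b-bsdres-x9/g15/desc5s4/j129707/certs/cert_168948a1.txt.gz`): `S = [2, 3, 5, 13, 19]`, `#gens R(S,5) = 39`, `5`-saturation
`[1, 129, 39]`, `dim K_S(R) = 0`, all local images complete, Galois action proved by characters,
**`dim_𝔽₅ Sel^(5)(E/ℚ) = 0`**; verifier: VERIFIED; the class group of `R` (`bnfinit`: `Cl(R) = [6, [6]]`, `Cl_S(R) = [1, []]`) CERTIFIED UNCONDITIONALLY by a Zimmert certificate (Bordellès Thm. 7.51 bound `Z = 1684755394`; every prime ideal of norm `≤ Z` decomposed on PARI's generators and verified exactly, up to the free action of `Aut(R) ≅ C₄` on degree-1 primes; 83444818 ideals, 0 failures; so `Cl(R)` is a quotient of `[6]` (PARI's cycle structure), generated by the exactly verified classes of the `S`-primes, hence `Cl_S(R) = 1`; kit j127943, j127944, j127945, j127946, j127947, j127948, j127950, j127951, j127952, j127953, j127954,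 j127955, 105.3 core-h) — this certificate line is UNCONDITIONAL.
Binders: `hGZK`, `r_an ≤ 1`, `#Ш_an` a `5`-adic unit, `hSel`. Kernel: `Δ ≠ 0`.
[cite: Miller2011LMS, §1 and Def. 1.1] [cite: Cremona2006, Table 1 (Cremona label 168948a1)] -/
theorem bsdp_s168948a1 (hGZK : rank_eq_analyticRank_of_analyticRank_le_one)
    (W : WeierstrassCurve ℚ) (hW : W = ⟨0, 0, 0, -64838127, -448597462250⟩)
    (hr : W.analyticRank ≤ 1) {q : ℚ} (hq : shaAn W = (q : ℂ)) (hv : padicValRat 5 q = 0)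
    (hSel : Nat.card (W.selmerGroup (5 : ℤ)) = 5 ^ W.analyticRank) : BSDp W 5 := by
  subst hW
  haveI : Fact (Nat.Prime 5) := ⟨by norm_num⟩
  exact bsdp_of_ainvs_of_card_selmerGroup hGZK 0 0 0 (-64838127) (-448597462250) (by decide +kernel) 5
    hr hq hv hSel

/-! ### Composition: `168948a1 @ 5` by transport from `12996j1` with NO `BSDp` binder -/

/-- **`BSD(E,5)` for `168948a1` through its partner `12996j1`, NO `BSDp` binder**: the part-C record
`bsdp_t168948a1_of_bsdp_s12996j1` (`X9/TransportPairsC.lean`) with `hbsdA` discharged by `bsdp_s12996j1` above (exact `5`-descent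
`#Sel⁵(A) = 5`, kit j127696 VERIFIED; the class group of the SHARED degree-24 field Zimmert-CERTIFIED, campaign F1). So the T-JET literal
cell `168948a1 @ 5` has, besides its own now-unconditional descent line (`bsdp_s168948a1` above), a transport route resting on PUBLISHED
binders (`hKO … hGZK`) and FINITE certificates only: `r_an(E) = 0`; `r_an(A) ≤ 1`, `#Ш_an(A) = q` with `ord₅ q = 0`, `hSelA`; C1 `hcong`
(`B = 63 839`, `6 399` primes, PARI + ENGINE D, kit j127638); C2 `hcertA` (gen 9 MU-ALL, two engines; `A` anomalous at `5`, `λ = 1`);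
C3 `hSchA` (PARI `ellpadicheight` `v₅(f − s₂g) = 2` + Mazur–Tate σ `v₅(h) = 1`, kit j127638). Per pair; nothing booked.
[cite: GreenbergVatsal2000, Thm. (1.4) (arXiv p. 5)] [cite: KrausOesterle1992, Prop. 4] [cite: Miller2011LMS, Def. 1.1]
[cite: Cremona2006, Table 1 (Cremona labels 168948a1, 12996j1)] -/
theorem bsdp_t168948a1'
    (hKO : KrausOesterle1992.prop4_torsionIso_of_congruences)
    (hBCS : burungale_castella_skinner_charIdeal_eq_padicLFunction)
    (hGr : greenberg_charValue_rankZero) (h5 : realPeriodRat_eq_unit_mul_plusPeriod)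
    (hGV : GreenbergVatsal2000.thm14_mainConjecture_transfer_of_torsionIso)
    (hS : Schneider1985_order_charGenerator) (hPR : perrinRiou_rankOne_leadingTerms)
    (hmodP : nonempty_modularParametrizationData) (hmodL : hasEntireLFunction_rat)
    (hGZK : rank_eq_analyticRank_of_analyticRank_le_one)
    (W A : WeierstrassCurve ℚ) [W.IsElliptic] [W.IsGloballyMinimal] [A.IsElliptic] [A.IsGloballyMinimal]
    [Fact (Nat.Prime 5)]
    (hW : W = ⟨0, 0, 0, -64838127, -448597462250⟩) (hA : A = ⟨0, 0, 0, -20577, -912247⟩)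
    (hr : W.analyticRank = 0) (hrA : A.analyticRank ≤ 1)
    {qA : ℚ} (hqA : shaAn A = (qA : ℂ)) (hvA : padicValRat 5 qA = 0)
    (hSelA : Nat.card (A.selmerGroup (5 : ℤ)) = 5 ^ A.analyticRank)
    (hSchA : A.analyticRank = 1 → ∀ Dh : PAdicHeightData A 5, Dh.IsCanonical → SchneiderConjecture Dh)
    (hcertA : ∀ [NeZero (A.conductorNorm ℤ)] (fA : CuspForm (Gamma0 (A.conductorNorm ℤ)) 2),
        IsNewformOf A fA → ∀ (ϖ : ℚ), (ϖ : ℝ) * A.realPeriodRat = plusPeriod fA →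
      ∃ n : ℕ, ‖PowerSeries.coeff n
        (PowerSeries.C (ϖ : ℚ_[5]) * padicLFunction fA (unitRoot A 5 : ℚ_[5]))‖ = 1)
    (hcong : ∀ (ℓ : ℕ) [Fact ℓ.Prime],
      6 * ℓ < KrausOesterle1992.gammaZeroIndex (KrausOesterle1992.modulus W A) →
      (padicValNat ℓ (W.conductorNorm ℤ * A.conductorNorm ℤ) = 0 →
          (5 : ℤ) ∣ W.frobeniusTrace ℓ - A.frobeniusTrace ℓ) ∧
        (padicValNat ℓ (W.conductorNorm ℤ * A.conductorNorm ℤ) = 1 →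
          (5 : ℤ) ∣ W.frobeniusTrace ℓ * A.frobeniusTrace ℓ - (ℓ + 1))) :
    BSDp W 5 :=
  bsdp_t168948a1_of_bsdp_s12996j1 hKO hBCS hGr h5 hGV hS hPR hmodP hmodL hGZK W A hW hA hr hrA
    (bsdp_s12996j1 hGZK A hA hrA hqA hvA hSelA) hSchA hcertA hcong

end Summit.BirchSwinnertonDyer.Rank1Residual.X9

end
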